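import Mathlib
import Literature.Combinatorics.AssociationSchemes.Basic
import Summits.MatrixMultiplication.MatrixMultiplication.Theorems.CommutativeSchemesSTPPTransferSymPower

/-!
# MatrixMultiplication / CommutativeSchemes — the cube of a commutative realisation

Crux `CommutativeRealization` (stmt-MatrixMultiplication-9462, Cohn–Umans 2013 Conjecture 21 in
ε-form), line `birth`, stub `stub_commutativeRealization_cube`: if a commutative association scheme
`S` on `X` with classes labelled by `Fin r` realises `⟨l, m, n⟩` (CU13 Def. 12), then some
commutative association scheme on `X × X × X` with at most `r ^ 3` class labels realises the cube
`⟨l m n, l m n, l m n⟩`.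

This is the first paragraph of the proof of Cohn–Umans 2013 Thm. 17 ("`𝒞^k` realizes
`⟨L, M, N⟩`") for the direct product of CU13 §4.2, combined with the cyclic symmetry of
Def. 11/12:

* `isTriangle_rotate`: triangles of classes are invariant under cyclic rotation, so a realisation
  `(α, β, γ)` of `⟨l, m, n⟩` also gives the rotated triangle conditions for `(β, γ, α)` and
  `(γ, α, β)`;
* `card_filter_triple`, `exists_triple_scheme`: the **direct product** `S × S × S` on `X × X × X`,
  whose class of `((x₁,x₂,x₃), (y₁,y₂,y₃))` is the triple of classes; its intersection numbers are
  products of those of `S` (the solution set of a coordinatewise condition is a product of finsets),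
  so it is an association scheme, commutative when `S` is;
* `isTriangle_triple`, `realizes_triple`: triangles in the product are componentwise triangles, and
  indexing the three sides of the cube by `[l]×[m]×[n]`, `[m]×[n]×[l]`, `[n]×[l]×[m]` with
  `α_T = (α, β, γ)`, `β_T = (β, γ, α)`, `γ_T = (γ, α, β)` componentwise realises `⟨N, N, N⟩`,
  `N = l m n` (injectivity of the three maps is automatic for a square shape,
  `injective_of_triangle_iff`);
* `exists_relabel_scheme`: relabelling the classes along `Fin r × Fin r × Fin r ≃ Fin (r ^ 3)`
  preserves the scheme axioms, commutativity and realisation.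

References: H. Cohn, C. Umans, *Fast matrix multiplication using coherent configurations*,
SODA 2013, arXiv:1207.6528, §4.2 (direct product of coherent configurations), Def. 11/12,
§5 Thm. 17 (first paragraph of the proof).
-/

-- the tree's namespace `Summit.MatrixMultiplication.MatrixMultiplication.…` repeats a component by design
set_option linter.dupNamespace false

namespace Summit.MatrixMultiplication.MatrixMultiplication.Theorems

open Finset Function Literature.Combinatorics.AssociationSchemes

section Triangles

variable {X ι : Type*}

/-- Cyclic symmetry of CU13 Def. 11: the classes `i, j, k` form a triangle iff `j, k, i` do
(rotate the witnesses `(x, y, z) ↦ (y, z, x)`). [cite: CohnUmans2013, Def. 11] -/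
theorem isTriangle_rotate (cls : X → X → ι) (i j k : ι) :
    IsTriangle cls i j k ↔ IsTriangle cls j k i :=
  ⟨fun ⟨x, y, z, h1, h2, h3⟩ => ⟨y, z, x, h2, h3, h1⟩,
    fun ⟨y, z, x, h2, h3, h1⟩ => ⟨x, y, z, h1, h2, h3⟩⟩

/-- Triangles in the direct product `S × S × S` (class of a pair of triples = the triple of the
coordinate classes, CU13 §4.2) are exactly the componentwise triangles.
[cite: CohnUmans2013, §4.2] -/
theorem isTriangle_triple (cls : X → X → ι) (i j k : ι × ι × ι) :
    IsTriangle (fun x y : X × X × X => (cls x.1 y.1, cls x.2.1 y.2.1, cls x.2.2 y.2.2)) i j k ↔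
      IsTriangle cls i.1 j.1 k.1 ∧ IsTriangle cls i.2.1 j.2.1 k.2.1 ∧
        IsTriangle cls i.2.2 j.2.2 k.2.2 := by
  constructor
  · rintro ⟨x, y, z, rfl, rfl, rfl⟩
    exact ⟨⟨x.1, y.1, z.1, rfl, rfl, rfl⟩, ⟨x.2.1, y.2.1, z.2.1, rfl, rfl, rfl⟩,
      ⟨x.2.2, y.2.2, z.2.2, rfl, rfl, rfl⟩⟩
  · rintro ⟨⟨x₁, y₁, z₁, h₁, h₂, h₃⟩, ⟨x₂, y₂, z₂, h₄, h₅, h₆⟩, ⟨x₃, y₃, z₃, h₇, h₈, h₉⟩⟩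
    exact ⟨(x₁, x₂, x₃), (y₁, y₂, y₃), (z₁, z₂, z₃), Prod.ext h₁ (Prod.ext h₄ h₇),
      Prod.ext h₂ (Prod.ext h₅ h₈), Prod.ext h₃ (Prod.ext h₆ h₉)⟩

/-- **The direct product realises the cube** (Cohn–Umans 2013, proof of Thm. 17, first
paragraph, with the cyclic symmetry of Def. 11/12): if the class map `cls` realises `⟨l, m, n⟩`
through `(α, β, γ)`, then the class map of `S × S × S` on `X × X × X` realises
`⟨l m n, l m n, l m n⟩` through `α_T (a, b') = (α (a₁, b'₁), β (a₂, b'₂), γ (a₃, b'₃))`,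
`β_T (b, c') = (β (b₁, c'₁), γ (b₂, c'₂), α (b₃, c'₃))`, `γ_T (c, a') = (γ (c₁, a'₁), α (c₂, a'₂),
β (c₃, a'₃))` on the index sets `[l]×[m]×[n]`, `[m]×[n]×[l]`, `[n]×[l]×[m]` (numbered by
`Fin (l m n)`): the triangle condition splits into the three rotated triangle conditions of
`(α, β, γ)`, and injectivity is automatic for a square shape. [cite: CohnUmans2013, Thm. 17] -/
theorem realizes_triple (cls : X → X → ι) {l m n : ℕ} (h : Realizes cls l m n) :
    Realizes (fun x y : X × X × X => (cls x.1 y.1, cls x.2.1 y.2.1, cls x.2.2 y.2.2))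
      (l * m * n) (l * m * n) (l * m * n) := by
  obtain ⟨α, β, γ, -, -, -, H⟩ := h
  -- the two rotated triangle conditions
  have H2 : ∀ (a a' : Fin l) (b b' : Fin m) (c c' : Fin n),
      IsTriangle cls (β (b, c')) (γ (c, a')) (α (a, b')) ↔ (a = a' ∧ b = b' ∧ c = c') :=
    fun a a' b b' c c' => (isTriangle_rotate cls _ _ _).symm.trans (H a a' b b' c c')
  have H3 : ∀ (a a' : Fin l) (b b' : Fin m) (c c' : Fin n),
      IsTriangle cls (γ (c, a')) (α (a, b')) (β (b, c')) ↔ (a = a' ∧ b = b' ∧ c = c') :=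
    fun a a' b b' c c' => (isTriangle_rotate cls _ _ _).trans (H a a' b b' c c')
  -- numbering the three index sets by `Fin (l * m * n)`
  have hA : Fintype.card (Fin l × Fin m × Fin n) = l * m * n := by
    simp only [Fintype.card_prod, Fintype.card_fin]
    ring
  have hB : Fintype.card (Fin m × Fin n × Fin l) = l * m * n := by
    simp only [Fintype.card_prod, Fintype.card_fin]
    ring
  have hC : Fintype.card (Fin n × Fin l × Fin m) = l * m * n := by
    simp only [Fintype.card_prod, Fintype.card_fin]
    ring
  obtain ⟨eA⟩ : Nonempty (Fin (l * m * n) ≃ Fin l × Fin m × Fin n) :=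
    ⟨(Fintype.equivFinOfCardEq hA).symm⟩
  obtain ⟨eB⟩ : Nonempty (Fin (l * m * n) ≃ Fin m × Fin n × Fin l) :=
    ⟨(Fintype.equivFinOfCardEq hB).symm⟩
  obtain ⟨eC⟩ : Nonempty (Fin (l * m * n) ≃ Fin n × Fin l × Fin m) :=
    ⟨(Fintype.equivFinOfCardEq hC).symm⟩
  -- the three maps of the realisation
  obtain ⟨αT, hαT⟩ : ∃ αT : Fin (l * m * n) × Fin (l * m * n) → ι × ι × ι, ∀ q, αT q =
      (α ((eA q.1).1, (eB q.2).1), β ((eA q.1).2.1, (eB q.2).2.1), γ ((eA q.1).2.2, (eB q.2).2.2)) :=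
    ⟨_, fun q => rfl⟩
  obtain ⟨βT, hβT⟩ : ∃ βT : Fin (l * m * n) × Fin (l * m * n) → ι × ι × ι, ∀ q, βT q =
      (β ((eB q.1).1, (eC q.2).1), γ ((eB q.1).2.1, (eC q.2).2.1), α ((eB q.1).2.2, (eC q.2).2.2)) :=
    ⟨_, fun q => rfl⟩
  obtain ⟨γT, hγT⟩ : ∃ γT : Fin (l * m * n) × Fin (l * m * n) → ι × ι × ι, ∀ q, γT q =
      (γ ((eC q.1).1, (eA q.2).1), α ((eC q.1).2.1, (eA q.2).2.1), β ((eC q.1).2.2, (eA q.2).2.2)) :=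
    ⟨_, fun q => rfl⟩
  have key : ∀ a a' b b' c c' : Fin (l * m * n),
      IsTriangle (fun x y : X × X × X => (cls x.1 y.1, cls x.2.1 y.2.1, cls x.2.2 y.2.2))
        (αT (a, b')) (βT (b, c')) (γT (c, a')) ↔ (a = a' ∧ b = b' ∧ c = c') := by
    intro a a' b b' c c'
    rw [isTriangle_triple]
    simp only [hαT, hβT, hγT, H, H2, H3]
    rw [← eA.apply_eq_iff_eq (x := a), ← eB.apply_eq_iff_eq (x := b),
      ← eC.apply_eq_iff_eq (x := c)]
    simp only [Prod.ext_iff]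
    tauto
  obtain ⟨iα, iβ, iγ⟩ := injective_of_triangle_iff
    (fun x y : X × X × X => (cls x.1 y.1, cls x.2.1 y.2.1, cls x.2.2 y.2.2)) αT βT γT key
  exact ⟨αT, βT, γT, iα, iβ, iγ, key⟩

end Triangles

section ProductScheme

variable {X ι κ : Type*} [Fintype X] [DecidableEq ι] [DecidableEq κ]

/-- Intersection numbers of the direct product multiply (CU13 §4.2): the set of `z ∈ X × X × X`
with prescribed coordinate classes to `x` and from `y` is the product of the three coordinate
solution sets. [cite: CohnUmans2013, §4.2] -/
theorem card_filter_triple (cls : X → X → ι) (a b : ι × ι × ι) (x y : X × X × X) :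
    (univ.filter fun z : X × X × X =>
        (cls x.1 z.1, cls x.2.1 z.2.1, cls x.2.2 z.2.2) = a ∧
          (cls z.1 y.1, cls z.2.1 y.2.1, cls z.2.2 y.2.2) = b).card =
      (univ.filter fun z => cls x.1 z = a.1 ∧ cls z y.1 = b.1).card *
        ((univ.filter fun z => cls x.2.1 z = a.2.1 ∧ cls z y.2.1 = b.2.1).card *
          (univ.filter fun z => cls x.2.2 z = a.2.2 ∧ cls z y.2.2 = b.2.2).card) := by
  rw [← card_product, ← card_product]
  congr 1
  ext z
  simp only [mem_filter, mem_univ, true_and, mem_product, Prod.ext_iff]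
  constructor
  · rintro ⟨⟨h₁, h₂, h₃⟩, h₄, h₅, h₆⟩
    exact ⟨⟨h₁, h₄⟩, ⟨h₂, h₅⟩, h₃, h₆⟩
  · rintro ⟨⟨h₁, h₄⟩, ⟨h₂, h₅⟩, h₃, h₆⟩
    exact ⟨⟨h₁, h₂, h₃⟩, h₄, h₅, h₆⟩

/-- **The direct product `S × S × S` of an association scheme** (Cohn–Umans 2013 §4.2, "direct
product" of coherent configurations): on `X × X × X`, the class of `((x₁,x₂,x₃), (y₁,y₂,y₃))` is
the triple `(cls x₁ y₁, cls x₂ y₂, cls x₃ y₃)`. One diagonal class and closure under transposition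
hold componentwise, the intersection numbers are the products
`p a₁ b₁ c₁ · p a₂ b₂ c₂ · p a₃ b₃ c₃` (`card_filter_triple`), so the product is commutative when `S`
is; and it realises the cube of any `⟨l, m, n⟩` realised by `S` (`realizes_triple`).
[cite: CohnUmans2013, §4.2] -/
theorem exists_triple_scheme (S : AssociationScheme X ι) :
    ∃ T : AssociationScheme (X × X × X) (ι × ι × ι),
      (S.IsCommutative → T.IsCommutative) ∧
        ∀ l m n : ℕ, S.Realizes l m n → T.Realizes (l * m * n) (l * m * n) (l * m * n) := by
  obtain ⟨τ, hτ⟩ := S.exists_transpose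
  obtain ⟨p, hp⟩ := S.exists_card_filter_eq
  refine ⟨⟨fun x y => (S.cls x.1 y.1, S.cls x.2.1 y.2.1, S.cls x.2.2 y.2.2), fun x y z => ?_,
      ⟨fun k => (τ k.1, τ k.2.1, τ k.2.2), fun x y => ?_⟩,
      ⟨fun a b c => p a.1 b.1 c.1 * (p a.2.1 b.2.1 c.2.1 * p a.2.2 b.2.2 c.2.2),
        fun a b x y => ?_⟩⟩,
    fun hS a b x y => ?_, fun l m n h => realizes_triple S.cls h⟩
  · -- one diagonal class, componentwise
    simp only [Prod.ext_iff, S.cls_eq_cls_self_iff]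
  · -- transposition acts componentwise
    dsimp only
    rw [← hτ, ← hτ, ← hτ]
  · -- coherence: intersection numbers multiply
    dsimp only
    rw [card_filter_triple S.cls a b x y, hp, hp, hp]
  · -- commutativity, factor by factor
    dsimp only
    rw [card_filter_triple S.cls a b x y, card_filter_triple S.cls b a x y, hS a.1 b.1 x.1 y.1,
      hS a.2.1 b.2.1 x.2.1 y.2.1, hS a.2.2 b.2.2 x.2.2 y.2.2]

/-- Relabelling the classes of an association scheme along a bijection of label sets gives an
association scheme (same classes, new numbering) which is commutative if the original is and
realises whatever the original realises (Def. 12 does not depend on the numbering of the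
classes, `Realizes.map`). [cite: CohnUmans2013, §4.2] -/
theorem exists_relabel_scheme (T : AssociationScheme X ι) (e : ι ≃ κ) :
    ∃ T' : AssociationScheme X κ,
      (T.IsCommutative → T'.IsCommutative) ∧
        ∀ l m n : ℕ, T.Realizes l m n → T'.Realizes l m n := by
  obtain ⟨τ, hτ⟩ := T.exists_transpose
  obtain ⟨p, hp⟩ := T.exists_card_filter_eq
  have hfilter : ∀ (a b : κ) (x y : X),
      (univ.filter fun z => e (T.cls x z) = a ∧ e (T.cls z y) = b) =
        univ.filter fun z => T.cls x z = e.symm a ∧ T.cls z y = e.symm b := by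
    intro a b x y
    ext z
    simp only [mem_filter, mem_univ, true_and, e.apply_eq_iff_eq_symm_apply]
  refine ⟨⟨fun x y => e (T.cls x y), fun x y z => ?_, ⟨fun k => e (τ (e.symm k)), fun x y => ?_⟩,
      ⟨fun a b c => p (e.symm a) (e.symm b) (e.symm c), fun a b x y => ?_⟩⟩,
    fun hT a b x y => ?_, fun l m n h => Realizes.map e.injective h⟩
  · exact e.apply_eq_iff_eq.trans (T.cls_eq_cls_self_iff x y z)
  · dsimp only
    rw [e.symm_apply_apply, ← hτ]
  · dsimp only
    rw [hfilter, hp, e.symm_apply_apply]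
  · dsimp only
    rw [hfilter, hfilter]
    exact hT _ _ x y

end ProductScheme

/-- **Stub 3 of line `birth` — the cube of a commutative realisation** (Cohn–Umans 2013 §4.2
"direct product" + proof of Thm. 17, first paragraph, + the cyclic symmetry of Def. 11/12). If a
commutative association scheme `S` on `X` with class labels `Fin r` realises `⟨l, m, n⟩`, then the
direct product `S × S × S` on `X × X × X` — commutative, with its `Fin r × Fin r × Fin r` classes
renumbered by `Fin (r ^ 3)` — realises `⟨l m n, l m n, l m n⟩`; so `r' = r ^ 3` works.
[cite: CohnUmans2013, Thm. 17] -/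
theorem stub_commutativeRealization_cube :
    ∀ (X : Type) [Fintype X] (l m n r : ℕ) (S : AssociationScheme X (Fin r)),
      S.IsCommutative → S.Realizes l m n →
        ∃ (r' : ℕ) (T : AssociationScheme (X × X × X) (Fin r')),
          r' ≤ r ^ 3 ∧ T.IsCommutative ∧ T.Realizes (l * m * n) (l * m * n) (l * m * n) := by
  intro X _ l m n r S hS hR
  obtain ⟨T, hTc, hTr⟩ := exists_triple_scheme S
  have hcard : Fintype.card (Fin r × Fin r × Fin r) = r ^ 3 := by
    simp only [Fintype.card_prod, Fintype.card_fin]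
    ring
  obtain ⟨T', hT'c, hT'r⟩ := exists_relabel_scheme T (Fintype.equivFinOfCardEq hcard)
  exact ⟨r ^ 3, T', le_rfl, hT'c (hTc hS), hT'r _ _ _ (hTr l m n hR)⟩

end Summit.MatrixMultiplication.MatrixMultiplication.Theorems
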